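import Summits.Ventures.HodgeRepro.BallGenHolo
import Summits.Ventures.HodgeRepro.BallSubmersion

/-!
# The Jacobian is the derivative; translated exact forms; Lemma W ⇒ a submersion (seat p5)

Blind re-derivation cell `pub-hodge-repro`, seat `p5`.  Closes the gap between the cell's Lemma W (typer-2's
`lemmaW_iter`, p5's `Holo.lemmaW_generic`: the TRANSLATED covector fields `γ_l^*ω_l` are linearly
independent at a point / on an open dense set) and the open-mapping statement of `BallSubmersion.lean`
(independent differential covectors at `z` ⇒ open image): the missing calculus is that typer-2's explicit
Jacobian `JacE γ z` IS the Fréchet derivative of the Möbius action `actE γ` (so far only its cocycle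
`Jac_mul` was proved), whence the chain rule «the translate of an exact covector field is exact»,
`dcov (h ∘ actE γ) z = pullE γ (dcov h) z`.

* `WElin`, `hasFDerivAt_WE` — `z ↦ (γ·(z,1))_j` is affine with linear part `WElin γ j`;
* `JacCLM`, `hasFDerivAt_actE_coord`, **`hasFDerivAt_actE`**, `fderiv_actE` — `d(actE γ)_z = JacE γ z`
  (quotient rule on the ball, where the denominator `(γ·(z,1))_last` does not vanish);
* **`dcov_comp_actE`** — `d(h ∘ γ)_z = (JacE γ z)ᵀ · (dh)(γ z) = pullE γ (dcov h) z` (chain rule);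
* `analyticOnNhd_dcov` — the differential covector field of an analytic function is analytic;
* **`image_mem_nhds_of_linearIndependent_pullE_dcov`** — `g` functions `h_l` analytic at `γ_l z` whose
  translated exact forms `γ_l^*(dh_l)` are independent at `z` ⇒ `w ↦ (h_l(γ_l w))_l` maps every neighbourhood
  of `z` onto a neighbourhood of its value (a submersion at `z`); `…_ball` the `Ball p` / `pullback` form;
* **`exists_submersion_on_dense`** — R5 steps (2)+(4), local form, every `p`: for a dense `Δ ≤ U(p,1)` and
  `p` functions analytic near the ball, none locally constant on it, there are `γ_1, …, γ_p ∈ Δ` and an OPEN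
  DENSE set of points `z` of the ball at each of which `w ↦ (h_l(γ_l w))_l` is a submersion.

What stays on paper (ROUTE-C 13.2(a), 13.3(iv) second half): that the eigenforms are the `dh_l` of the
Albanese coordinates, and that an open image of a compact irreducible `S′` in `A′` is all of `A′`.

Nothing here says anything about the status of the Hodge conjecture for CM abelian varieties.
-/

set_option autoImplicit false

noncomputable section

namespace HodgeRepro.BallGen

namespace Jacob

open Matrix Filter Topology
open Holo Subm

variable {p : ℕ}

/-! ### The affine maps `z ↦ (γ·(z,1))_j` -/

/-- The linear part of `z ↦ (γ·(z,1))_j`: `v ↦ Σ_i mat γ j (inl i) * v i`. -/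
def WElin (g : U p) (j : Idx p) : (Fin p → ℂ) →L[ℂ] ℂ :=
  ∑ i, mat g j (Sum.inl i) • ContinuousLinearMap.proj (R := ℂ) (φ := fun _ : Fin p => ℂ) i

/-- `WElin` unfolded. -/
theorem WElin_apply (g : U p) (j : Idx p) (v : Fin p → ℂ) :
    WElin g j v = ∑ i, mat g j (Sum.inl i) * v i := by
  simp [WElin, ContinuousLinearMap.proj_apply]

/-- `z ↦ (γ·(z,1))_j` is differentiable with derivative `WElin γ j` (it is affine). -/
theorem hasFDerivAt_WE (g : U p) (j : Idx p) (z : Fin p → ℂ) :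
    HasFDerivAt (fun z => WE g z j) (WElin g j) z := by
  have h : (fun z : Fin p → ℂ => WE g z j) = fun z => WElin g j z + mat g j (last p) :=
    funext fun z => by rw [WE_apply, WElin_apply]
  rw [h]
  exact (WElin g j).hasFDerivAt.add_const _

/-! ### The Jacobian as a continuous linear map, and `d(actE γ) = JacE γ` -/

/-- The Jacobian `JacE γ z` as a continuous linear map `v ↦ JacE γ z *ᵥ v`. -/
def JacCLM (g : U p) (z : Fin p → ℂ) : (Fin p → ℂ) →L[ℂ] (Fin p → ℂ) :=
  LinearMap.toContinuousLinearMap (Matrix.toLin' (JacE g z))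

/-- `JacCLM` unfolded. -/
theorem JacCLM_apply (g : U p) (z v : Fin p → ℂ) : JacCLM g z v = JacE g z *ᵥ v := by
  simp [JacCLM, Matrix.toLin'_apply]

/-- The coordinates of `JacE γ z *ᵥ v` in terms of the affine maps, where the denominator does not vanish. -/
theorem JacCLM_apply_coord (g : U p) {z : Fin p → ℂ} (v : Fin p → ℂ) (i : Fin p)
    (hw : WE g z (last p) ≠ 0) :
    JacCLM g z v i = (WE g z (last p))⁻¹ ^ 2 *
      (WE g z (last p) * WElin g (Sum.inl i) v - WE g z (Sum.inl i) * WElin g (last p) v) := by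
  rw [JacCLM_apply]
  simp only [Matrix.mulVec, dotProduct, JacE, Matrix.of_apply, WElin_apply, Finset.mul_sum,
    ← Finset.sum_sub_distrib]
  refine Finset.sum_congr rfl fun j _ => ?_
  field_simp

/-- **The coordinates of the action are differentiable on the ball, with derivative the rows of `JacE`.** -/
theorem hasFDerivAt_actE_coord (g : U p) (i : Fin p) {z : Fin p → ℂ} (hz : z ∈ ballSet p) :
    HasFDerivAt (fun z => actE g z i)
      ((ContinuousLinearMap.proj (R := ℂ) (φ := fun _ : Fin p => ℂ) i).comp (JacCLM g z)) z := by
  have hw : WE g z (last p) ≠ 0 := WE_last_ne_zero g hz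
  have hi := hasFDerivAt_WE g (Sum.inl i) z
  have hL := hasFDerivAt_WE g (last p) z
  have hinv : HasFDerivAt (fun z => (WE g z (last p))⁻¹)
      ((-ContinuousLinearMap.mulLeftRight ℂ ℂ (WE g z (last p))⁻¹ (WE g z (last p))⁻¹).comp
        (WElin g (last p))) z :=
    (hasFDerivAt_inv' hw).comp z hL
  have h : (fun z : Fin p → ℂ => actE g z i) = fun z => WE g z (Sum.inl i) * (WE g z (last p))⁻¹ :=
    funext fun z => div_eq_mul_inv _ _
  rw [h]
  refine (hi.fun_mul hinv).congr_fderiv ?_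
  ext v
  simp only [ContinuousLinearMap.comp_apply, _root_.add_apply, _root_.smul_apply, _root_.neg_apply,
    ContinuousLinearMap.mulLeftRight_apply, ContinuousLinearMap.proj_apply, smul_eq_mul,
    JacCLM_apply_coord g v i hw]
  field_simp
  ring

/-- **`JacE γ z` is the Fréchet derivative of the action `actE γ` at every point of the ball.** -/
theorem hasFDerivAt_actE (g : U p) {z : Fin p → ℂ} (hz : z ∈ ballSet p) :
    HasFDerivAt (actE g) (JacCLM g z) z := by
  have h := hasFDerivAt_pi.2 fun i => hasFDerivAt_actE_coord g i hz
  refine h.congr_fderiv ?_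
  ext v i
  simp

/-- `fderiv ℂ (actE γ) z = JacCLM γ z` on the ball. -/
theorem fderiv_actE (g : U p) {z : Fin p → ℂ} (hz : z ∈ ballSet p) :
    fderiv ℂ (actE g) z = JacCLM g z :=
  (hasFDerivAt_actE g hz).fderiv

/-! ### The translate of an exact covector field is exact -/

/-- A linear functional on `ℂ^p` is determined by its values on the canonical basis. -/
theorem clm_apply_eq_sum (L : (Fin p → ℂ) →L[ℂ] ℂ) (v : Fin p → ℂ) :
    L v = ∑ k, v k * L (Pi.single k 1) := by
  conv_lhs => rw [pi_eq_sum_univ' v]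
  rw [map_sum]
  refine Finset.sum_congr rfl fun k _ => ?_
  rw [map_smul, smul_eq_mul]

/-- **Chain rule for exact covector fields.**  `d(h ∘ actE γ)_z = (JacE γ z)ᵀ · (dh)(actE γ z)`, i.e. the
differential covector of `h ∘ γ` at `z` is the translate `γ^*(dh)` at `z`. -/
theorem dcov_comp_actE (g : U p) {h : (Fin p → ℂ) → ℂ} {z : Fin p → ℂ} (hz : z ∈ ballSet p)
    (hh : DifferentiableAt ℂ h (actE g z)) :
    dcov (h ∘ actE g) z = pullE g (fun w => dcov h w) z := by
  ext i
  rw [pullE_apply]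
  simp only [dcov]
  rw [fderiv_comp z hh (hasFDerivAt_actE g hz).differentiableAt, ContinuousLinearMap.comp_apply,
    fderiv_actE g hz, JacCLM_apply, Matrix.mulVec_single_one, clm_apply_eq_sum]
  rfl

/-- The differential covector field of an analytic function is analytic. -/
theorem analyticOnNhd_dcov {h : (Fin p → ℂ) → ℂ} {s : Set (Fin p → ℂ)} (hh : AnalyticOnNhd ℂ h s) :
    AnalyticOnNhd ℂ (fun w => dcov h w) s := fun w hw =>
  AnalyticAt.pi fun i =>
    ((ContinuousLinearMap.apply ℂ ℂ (Pi.single i (1 : ℂ) : Fin p → ℂ)).analyticAt _).comp (hh.fderiv w hw)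

/-! ### Lemma W's output ⇒ a submersion -/

/-- **Translated exact forms independent at `z` ⇒ a submersion at `z`.**  Let `h_1, …, h_g` be analytic at
the translated points `γ_l z` and let the translates `γ_l^*(dh_l)` be linearly independent at `z ∈ 𝔹^p`.
Then `w ↦ (h_l(γ_l w))_l` maps every neighbourhood of `z` onto a neighbourhood of its value. -/
theorem image_mem_nhds_of_linearIndependent_pullE_dcov {g : ℕ} (h : Fin g → (Fin p → ℂ) → ℂ)
    (γ : Fin g → U p) {z : Fin p → ℂ} (hz : z ∈ ballSet p) (ha : ∀ l, AnalyticAt ℂ (h l) (actE (γ l) z))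
    (hli : LinearIndependent ℂ fun l => pullE (γ l) (fun w => dcov (h l) w) z)
    {U : Set (Fin p → ℂ)} (hU : U ∈ 𝓝 z) :
    (fun w l => h l (actE (γ l) w)) '' U ∈ 𝓝 fun l => h l (actE (γ l) z) := by
  have heq : (fun l => dcov (h l ∘ actE (γ l)) z) = fun l => pullE (γ l) (fun w => dcov (h l) w) z :=
    funext fun l => dcov_comp_actE (γ l) hz (ha l).differentiableAt
  have hli' : LinearIndependent ℂ fun l => dcov (h l ∘ actE (γ l)) z := by
    rw [heq]
    exact hli
  exact image_mem_nhds_of_linearIndependent_dcov (fun l => h l ∘ actE (γ l))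
    (fun l => (ha l).comp (analyticAt_actE_fun (γ l) hz)) hli' hU

/-- The same on the ball `Ball p` in typer-2's `pullback` vocabulary (the output shape of `lemmaW_iter` /
`lemmaW_generic`). -/
theorem image_mem_nhds_of_linearIndependent_pullback_dcov {g : ℕ} (h : Fin g → (Fin p → ℂ) → ℂ)
    (γ : Fin g → U p) (z : Ball p) (ha : ∀ l, AnalyticAt ℂ (h l) (actE (γ l) z.1))
    (hli : LinearIndependent ℂ fun l => pullback (γ l) (fun w : Ball p => dcov (h l) w.1) z)
    {U : Set (Fin p → ℂ)} (hU : U ∈ 𝓝 z.1) :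
    (fun w l => h l (actE (γ l) w)) '' U ∈ 𝓝 fun l => h l (actE (γ l) z.1) :=
  image_mem_nhds_of_linearIndependent_pullE_dcov h γ z.2 ha hli hU

/-- **R5 steps (2)+(4), local form, every `p` (Lemma W + open mapping).**  For a dense `Δ ≤ U(p,1)` (the
rational points of the route's group) and `p` functions `h_1, …, h_p` analytic on a neighbourhood of the ball,
none locally constant on it (`dh_l ≢ 0` on `𝔹^p`), there are `γ_1, …, γ_p ∈ Δ` and an OPEN DENSE set `S` of
points of the ball at each of which `w ↦ (h_l(γ_l w))_l` is a submersion: it maps every neighbourhood of `z`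
onto a neighbourhood of its value. -/
theorem exists_submersion_on_dense {Δ : Subgroup (U p)} (hΔ : Dense (Δ : Set (U p)))
    {h : Fin p → (Fin p → ℂ) → ℂ} (hh : ∀ l, AnalyticOnNhd ℂ (h l) (ballSet p))
    (hh0 : ∀ l, ∃ w : Ball p, dcov (h l) w.1 ≠ 0) :
    ∃ γ : Fin p → U p, (∀ l, γ l ∈ Δ) ∧ ∃ S : Set (Ball p), IsOpen S ∧ Dense S ∧
      ∀ z ∈ S, ∀ U ∈ 𝓝 z.1,
        (fun w l => h l (actE (γ l) w)) '' U ∈ 𝓝 fun l => h l (actE (γ l) z.1) := by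
  have hF : ∀ l, AnalyticOnNhd ℂ (fun w => dcov (h l) w) (ballSet p) := fun l => analyticOnNhd_dcov (hh l)
  obtain ⟨γ, hγ, hopen, hdense⟩ := lemmaW_generic hΔ hF hh0
  refine ⟨γ, hγ, _, hopen, hdense, fun z hz U hU => ?_⟩
  exact image_mem_nhds_of_linearIndependent_pullback_dcov h γ z
    (fun l => hh l _ (actE_mem_ballSet (γ l) z.2)) hz hU

end Jacob

end HodgeRepro.BallGen

end
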